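import Literature.NumberTheory.EllipticCurves.ZpCorankLevelProfile
import Literature.NumberTheory.EllipticCurves.IwasawaLeadingTermProofs
import HarnessLib

/-!
# The level profile of a `Ш`-component: `#Ш(E/K)[p^e] = p^{e·t_p + 2 m_e}`, the second-descent door,
# and the `(p, p²)` reading table

Topic `Literature/NumberTheory/EllipticCurves`, family `bsd`. Theorems only (no definition, no named
fact; D-0026). For an elliptic curve `E` (Weierstrass model `W`) over a number field `K` and a prime `p`
write `t_p(E) = W.shaCorank p = corank_{ℤ_p} Ш(E/K)[p^∞]` (file `Selmer`; Greenberg, LNM 1716, §1) and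
`Ш[p^e] = (W.sha)[p^e]`. The Cassels–Tate pairing enters, where used, as the explicit hypothesis
`(hCT : WeierstrassCurve.exists_casselsTate_pairing)` (bsd.S18: alternating, kernel = divisible
elements; Cassels 1962, Milne *ADT* I.6.13; in the tree it is a THEOREM for every number field, file
`Summits/…/GenusKolyvaginAtTwoCasselsTatePairingRat`, so Summits-side users discharge `hCT`).

What ONE complete `p`-descent reads is `#Ш[p] = p^{t_p + 2m}` (Dokchitser, *Notes on the parity
conjecture*, §2: "`Ш[p^∞] ≅ (ℚ_p/ℤ_p)^{δ_p} ×` (finite group of square order)"; tree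
`exists_natCard_modN_primaryComponent_sha` / seat file `…OddDoor`). This file gives what a descent AT
EVERY LEVEL reads, i.e. the full structure `Ш(E/K)[p^∞] ≅ (ℚ_p/ℤ_p)^{t_p} ⊕ L ⊕ L` counted level by level
(pure algebra in `ZpCorankLevelProfile`):

* §1 `exists_sha_levelProfile` (**the profile**, `hCT`): there is `m : ℕ → ℕ`, `m 0 = 0`, monotone,
  eventually constant, with **`#Ш(E/K)[p^e] = p^{e·t_p(E) + 2·m e}` for every `e`**. Corollaries:
  `#Ш[p^e] = p^{e t_p}·c²`; `#Ш[p^e]` is a square iff `e·t_p` is even — so **`#Ш[p²]`, `#Ш[p⁴]`, … are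
  ALWAYS squares** while `#Ш[p]`, `#Ш[p³]`, … are squares iff `t_p` is even; `p^{e t_p} ∣ #Ш[p^e]`;
  reading `#Ш[p^e] = p^d`: `d = e·t_p + 2m`.
* §2 TWO CONSECUTIVE LEVELS (`hCT`): `#Ш[p^{e+1}] = p^{t_p + 2j}·#Ш[p^e]` with `j ≥ 0`
  (`exists_natCard_sha_torsionBy_pow_succ_eq`), eventually with `j = 0`; so from `#Ш[p^e] = p^a`,
  `#Ш[p^{e+1}] = p^b` one reads **`t_p ≤ b − a`** and `t_p ≡ b − a (mod 2)`: two consecutive descents bound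
  the corank FROM ABOVE by their difference; a step of exactly one factor `p` certifies `t_p = 1`
  (`shaCorank_eq_one_of_natCard_succ_eq_mul`), i.e. an infinite `Ш[p^∞]`.
* §3 THE SECOND-DESCENT DOOR (no pairing needed): **`#Ш[p^{e+1}] = #Ш[p^e] ⟹ Ш[p^∞] = Ш[p^e]` is finite
  and `t_p(E) = 0`** (`primaryComponent_sha_eq_torsionBy_of_natCard_succ_eq`,
  `shaCorank_eq_zero_of_natCard_sha_torsionBy_pow_succ_eq`), and then `#Ш[p^k] = #Ш[p^e]` for all
  `k ≥ e` — the COMPLETE `p`-primary component. In particular **`#Ш[p²] = #Ш[p] ⟹ t_p = 0`**: e.g.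
  `#Ш(E/K)[2] = 4 = #Ш(E/K)[4]` (a `2`-descent and a `4`-descent, Cassels 1998 / Merriman–Siksek–Smart)
  closes the door at `2` although `Ш[2] ≠ 0`. With the pairing: **`t_p = 0 ⟺ ∃ e, #Ш[p^{e+1}] = #Ш[p^e]
  ⟺ (#Ш[p^e])_e is bounded`** (`shaCorank_eq_zero_iff_exists_natCard_succ_eq`,
  `shaCorank_eq_zero_iff_natCard_bounded`). Also, pairing-free, `#Ш[p^{e+1}] ≤ #Ш[p^e]·#Ш[p]`.
* §4 THE `(p, p²)` READING TABLE (`hCT`): from `#Ш[p] = p^a`, `#Ш[p²] = p^b`: `b` even, `a ≤ b ≤ 2a`,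
  `t_p ≤ b − a`, `t_p ≡ a ≡ b − a (mod 2)` (`levelTwo_reading`); hence `(a, b) = (a, a) ⟹ t_p = 0`,
  `(a, a+1) ⟹ t_p = 1`, `(2, 4) ⟹ t_p ∈ {0, 2}`, `(2, 3)` and `(0, b > 0)` impossible.

Nothing here is specific to `ℚ`; nothing here proves the finiteness of `Ш`.

## References

* R. Greenberg, *Iwasawa theory for elliptic curves*, LNM 1716 (1999), §1, pp. 54–57. [Greenberg1999LNM]
* T. Dokchitser, *Notes on the parity conjecture*, in: Elliptic curves, Hilbert modular forms and Galois
  deformations, Birkhäuser (2013), §2. [Dokchitser2013ParityNotes]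
* J. W. S. Cassels, *Arithmetic on curves of genus 1. IV. Proof of the Hauptvermutung*, J. reine angew.
  Math. 211 (1962), 95–112. [Cassels1962ArithmeticIV]
* J. S. Milne, *Arithmetic Duality Theorems*, 2nd ed. (2006), I.6.13(a). [MilneADT2006]
* J. H. Silverman, *The Arithmetic of Elliptic Curves*, 2nd ed. (2009), Thm. X.4.14, Thm. X.4.2(b).
  [SilvermanAEC2009]
-/

noncomputable section

open scoped Classical
open scoped AddSubgroup
open Literature.Algebra.Module

namespace Literature.NumberTheory.EllipticCurves

universe u

/-! ### An arithmetic helper -/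

/-- For a prime `p`, `p ^ n` is a perfect square iff `n` is even. [folklore] -/
private theorem isSquare_prime_pow_iff' (p : ℕ) [hp : Fact p.Prime] {n : ℕ} : IsSquare (p ^ n) ↔ Even n := by
  constructor
  · rintro ⟨a, ha⟩
    have hdvd : a ∣ p ^ n := Dvd.intro _ ha.symm
    obtain ⟨k, -, rfl⟩ := (Nat.dvd_prime_pow hp.out).mp hdvd
    rw [← pow_add] at ha
    exact ⟨k, Nat.pow_right_injective hp.out.two_le ha⟩
  · rintro ⟨k, rfl⟩
    exact ⟨p ^ k, by rw [← pow_add]⟩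

open WeierstrassCurve

variable {K : Type u} [Field K] [NumberField K] (W : WeierstrassCurve K) [W.IsElliptic]
  (p : ℕ) [hp : Fact p.Prime]

/-! ### Bridges between `Ш[p^e]` and `Ш[p^∞][p^e]` -/

omit [W.IsElliptic] hp in
/-- `Ш[p^e] ≤ Ш[p^∞]`. [cite: Greenberg1999LNM, §1 (pp. 54–57)] -/
theorem sha_torsionBy_pow_le_primaryComponent (e : ℕ) :
    W.sha[((p ^ e : ℕ) : ℤ)] ≤ AddCommGroup.primaryComponent W.sha p := fun _ hx ↦
  (AddCommGroup.mem_primaryComponent).mpr ⟨e, AddSubgroup.torsionBy.nsmul_iff.mp hx⟩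

omit [W.IsElliptic] hp in
/-- `#(Ш[p^∞][p^e]) = #Ш[p^e]`: the `p^e`-torsion of `Ш` lies in its `p`-primary component.
[cite: Greenberg1999LNM, §1 (pp. 54–57)] -/
theorem natCard_torsionBy_pow_primaryComponent_sha (e : ℕ) :
    Nat.card ((↥(AddCommGroup.primaryComponent W.sha p))[((p ^ e : ℕ) : ℤ)]) =
      Nat.card (W.sha[((p ^ e : ℕ) : ℤ)]) := by
  rw [natCard_torsionBy_addSubgroup]
  exact congrArg (fun H : AddSubgroup W.sha ↦ Nat.card H)
    (inf_eq_right.mpr (sha_torsionBy_pow_le_primaryComponent W p e))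

/-- `Ш[p^e]` is finite (weak Mordell–Weil: `Ш[n]` is finite, Silverman X.4.2(b), tree
`finite_sha_torsionBy_holds`). [cite: SilvermanAEC2009, Thm. X.4.2(b)] -/
theorem finite_sha_torsionBy_pow (e : ℕ) : Finite (W.sha[((p ^ e : ℕ) : ℤ)]) :=
  W.finite_sha_torsionBy_holds _ (by exact_mod_cast (pow_pos hp.out.pos e).ne')

/-! ### §1 The level profile of `Ш(E/K)[p^∞]` -/

/-- **The level profile of a `Ш`-component.** Granting the Cassels–Tate pairing (`hCT`), for an elliptic
curve over a number field and a prime `p` there is `m : ℕ → ℕ` with `m 0 = 0`, monotone and eventually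
constant, such that **`#Ш(E/K)[p^e] = p ^ (e · t_p(E) + 2 · m e)` for every `e`** — the count of
`Ш(E/K)[p^∞] ≅ (ℚ_p/ℤ_p)^{t_p} ⊕ L ⊕ L` (`#L[p^e] = p^{m e}`).
[cite: Dokchitser2013ParityNotes, §2 (first display)] [cite: Greenberg1999LNM, §1 (pp. 54–57)] -/
theorem exists_sha_levelProfile (hCT : exists_casselsTate_pairing (K := K)) :
    ∃ m : ℕ → ℕ, m 0 = 0 ∧ Monotone m ∧ (∃ e₀ : ℕ, ∀ e, e₀ ≤ e → m e = m e₀) ∧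
      ∀ e : ℕ, Nat.card (W.sha[((p ^ e : ℕ) : ℤ)]) = p ^ (e * W.shaCorank p + 2 * m e) := by
  obtain ⟨hA, hfin, BA, halt, hker⟩ := exists_pairing_primaryComponent_sha W p hCT
  haveI := hfin
  obtain ⟨m, h0, hmono, hev, hcount⟩ := exists_levelProfile_of_pairing p hA BA halt hker
  refine ⟨m, h0, hmono, hev, fun e ↦ ?_⟩
  rw [← natCard_torsionBy_pow_primaryComponent_sha W p e]
  exact hcount e

/-- **`#Ш(E/K)[p^e] = p^{e·t_p} · c²`** (granting Cassels–Tate). [cite: Dokchitser2013ParityNotes, §2] -/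
theorem exists_natCard_sha_torsionBy_pow_eq_mul_sq (hCT : exists_casselsTate_pairing (K := K)) (e : ℕ) :
    ∃ c : ℕ, Nat.card (W.sha[((p ^ e : ℕ) : ℤ)]) = p ^ (e * W.shaCorank p) * c ^ 2 := by
  obtain ⟨m, -, -, -, h⟩ := exists_sha_levelProfile W p hCT
  exact ⟨p ^ m e, by rw [h e, pow_add, ← pow_mul, mul_comm (m e) 2]⟩

/-- **`p^{e·t_p(E)}` divides `#Ш(E/K)[p^e]`** (granting Cassels–Tate). [cite: Dokchitser2013ParityNotes, §2] -/
theorem pow_mul_shaCorank_dvd_natCard_sha_torsionBy_pow (hCT : exists_casselsTate_pairing (K := K))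
    (e : ℕ) : p ^ (e * W.shaCorank p) ∣ Nat.card (W.sha[((p ^ e : ℕ) : ℤ)]) := by
  obtain ⟨c, hc⟩ := exists_natCard_sha_torsionBy_pow_eq_mul_sq W p hCT e
  exact ⟨c ^ 2, hc⟩

/-- **Reading a complete `p^e`-descent**: if `#Ш(E/K)[p^e] = p^d` then `d = e·t_p(E) + 2m` for some `m`
(granting Cassels–Tate); for `e = 1` this is the tree's `exists_eq_shaCorank_add_two_mul` shape.
[cite: Dokchitser2013ParityNotes, §2] -/
theorem exists_eq_mul_shaCorank_add_two_mul (hCT : exists_casselsTate_pairing (K := K)) {e d : ℕ}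
    (hd : Nat.card (W.sha[((p ^ e : ℕ) : ℤ)]) = p ^ d) : ∃ m : ℕ, d = e * W.shaCorank p + 2 * m := by
  obtain ⟨m, -, -, -, h⟩ := exists_sha_levelProfile W p hCT
  exact ⟨m e, Nat.pow_right_injective hp.out.two_le (hd.symm.trans (h e))⟩

/-- `e · t_p(E) ≤ log_p #Ш(E/K)[p^e]` and the two have the same parity: if `#Ш[p^e] = p^d` then
`e·t_p ≤ d` and `d ≡ e·t_p (mod 2)` (granting Cassels–Tate). [cite: Dokchitser2013ParityNotes, §2] -/
theorem mul_shaCorank_le_and_mod_two_eq (hCT : exists_casselsTate_pairing (K := K)) {e d : ℕ}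
    (hd : Nat.card (W.sha[((p ^ e : ℕ) : ℤ)]) = p ^ d) :
    e * W.shaCorank p ≤ d ∧ d % 2 = (e * W.shaCorank p) % 2 := by
  obtain ⟨m, hm⟩ := exists_eq_mul_shaCorank_add_two_mul W p hCT hd
  omega

/-- **`#Ш(E/K)[p^e]` is a perfect square iff `e · t_p(E)` is even** (granting Cassels–Tate): at EVEN
levels the descent defect is always a square; at ODD levels it is a square iff `t_p` is even.
[cite: Dokchitser2013ParityNotes, §2] [cite: Cassels1962ArithmeticIV, §1] -/
theorem isSquare_natCard_sha_torsionBy_pow_iff (hCT : exists_casselsTate_pairing (K := K)) (e : ℕ) :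
    IsSquare (Nat.card (W.sha[((p ^ e : ℕ) : ℤ)])) ↔ Even (e * W.shaCorank p) := by
  obtain ⟨m, -, -, -, h⟩ := exists_sha_levelProfile W p hCT
  rw [h e, isSquare_prime_pow_iff' p, Nat.even_add]
  have h2 : Even (2 * m e) := even_two_mul _
  tauto

/-- **`#Ш(E/K)[p²]`, `#Ш(E/K)[p⁴]`, … are always perfect squares** (granting Cassels–Tate): the
`p^e`-descent defect at an even level `e` is a square whatever `t_p` is. [cite: Cassels1962ArithmeticIV, §1]
[cite: Dokchitser2013ParityNotes, §2] -/
theorem isSquare_natCard_sha_torsionBy_pow_of_even (hCT : exists_casselsTate_pairing (K := K)) {e : ℕ}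
    (he : Even e) : IsSquare (Nat.card (W.sha[((p ^ e : ℕ) : ℤ)])) :=
  (isSquare_natCard_sha_torsionBy_pow_iff W p hCT e).mpr (he.mul_right _)

/-! ### §2 Two consecutive levels -/

/-- **`#Ш[p^{e+1}] = p^{t_p + 2j} · #Ш[p^e]`** for some `j` (granting Cassels–Tate): one further level of
descent multiplies the defect by `p^{t_p}` times a square. [cite: Dokchitser2013ParityNotes, §2]
[cite: Greenberg1999LNM, §1 (pp. 54–57)] -/
theorem exists_natCard_sha_torsionBy_pow_succ_eq (hCT : exists_casselsTate_pairing (K := K)) (e : ℕ) :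
    ∃ j : ℕ, Nat.card (W.sha[((p ^ (e + 1) : ℕ) : ℤ)]) =
      p ^ (W.shaCorank p + 2 * j) * Nat.card (W.sha[((p ^ e : ℕ) : ℤ)]) := by
  obtain ⟨m, -, hmono, -, h⟩ := exists_sha_levelProfile W p hCT
  obtain ⟨j, hj⟩ := Nat.exists_eq_add_of_le (hmono (Nat.le_succ e))
  refine ⟨j, ?_⟩
  rw [h (e + 1), h e, ← pow_add, hj]
  ring_nf

/-- **Eventually each further level multiplies `#Ш[p^e]` by exactly `p^{t_p(E)}`** (granting Cassels–Tate):
there is `e₀` with `#Ш[p^{e+1}] = p^{t_p} · #Ш[p^e]` for all `e ≥ e₀`. [cite: Greenberg1999LNM, §1 (pp. 54–57)] -/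
theorem exists_forall_natCard_sha_torsionBy_pow_succ_eq (hCT : exists_casselsTate_pairing (K := K)) :
    ∃ e₀ : ℕ, ∀ e, e₀ ≤ e → Nat.card (W.sha[((p ^ (e + 1) : ℕ) : ℤ)]) =
      p ^ W.shaCorank p * Nat.card (W.sha[((p ^ e : ℕ) : ℤ)]) := by
  obtain ⟨m, -, -, ⟨e₀, he₀⟩, h⟩ := exists_sha_levelProfile W p hCT
  refine ⟨e₀, fun e he ↦ ?_⟩
  rw [h (e + 1), h e, ← pow_add, he₀ (e + 1) (by omega), he₀ e he]
  ring_nf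

/-- **Two consecutive descents bound the corank from above.** If `#Ш[p^e] = p^a` and `#Ш[p^{e+1}] = p^b`
then `a ≤ b`, **`t_p(E) ≤ b − a`** and `t_p(E) ≡ b − a (mod 2)` (granting Cassels–Tate).
[cite: Dokchitser2013ParityNotes, §2] [cite: Greenberg1999LNM, §1 (pp. 54–57)] -/
theorem shaCorank_le_sub_of_natCard_eq_pow (hCT : exists_casselsTate_pairing (K := K)) {e a b : ℕ}
    (ha : Nat.card (W.sha[((p ^ e : ℕ) : ℤ)]) = p ^ a)
    (hb : Nat.card (W.sha[((p ^ (e + 1) : ℕ) : ℤ)]) = p ^ b) :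
    a ≤ b ∧ W.shaCorank p ≤ b - a ∧ W.shaCorank p % 2 = (b - a) % 2 := by
  obtain ⟨j, hj⟩ := exists_natCard_sha_torsionBy_pow_succ_eq W p hCT e
  rw [ha, hb, ← pow_add] at hj
  have hbj := Nat.pow_right_injective hp.out.two_le hj
  omega

/-- **The odd step**: if one further level of descent multiplies the defect by exactly `p`,
`#Ш[p^{e+1}] = p · #Ш[p^e]`, then `t_p(E) = 1` — so `Ш(E/K)[p^∞]` is infinite (granting Cassels–Tate;
conjecturally this never happens). [cite: Dokchitser2013ParityNotes, §2] -/
theorem shaCorank_eq_one_of_natCard_succ_eq_mul (hCT : exists_casselsTate_pairing (K := K)) {e : ℕ}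
    (h : Nat.card (W.sha[((p ^ (e + 1) : ℕ) : ℤ)]) = p * Nat.card (W.sha[((p ^ e : ℕ) : ℤ)])) :
    W.shaCorank p = 1 := by
  obtain ⟨j, hj⟩ := exists_natCard_sha_torsionBy_pow_succ_eq W p hCT e
  haveI := finite_sha_torsionBy_pow W p e
  have hpos : 0 < Nat.card (W.sha[((p ^ e : ℕ) : ℤ)]) := Nat.card_pos
  rw [h] at hj
  have h1 : p ^ 1 = p ^ (W.shaCorank p + 2 * j) := by
    rw [pow_one]; exact Nat.eq_of_mul_eq_mul_right hpos hj
  have := Nat.pow_right_injective hp.out.two_le h1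
  omega

/-! ### §3 The second-descent door (no pairing needed) and the complete component -/

/-- **`#Ш[p^{e+1}] ≤ #Ш[p^e] · #Ш[p]`** (no pairing): one further level raises `log_p #Ш[p^·]` by at most
`dim_{𝔽_p} Ш[p]`. [cite: SilvermanAEC2009, Thm. X.4.2(b)] -/
theorem natCard_sha_torsionBy_pow_succ_le (e : ℕ) :
    Nat.card (W.sha[((p ^ (e + 1) : ℕ) : ℤ)]) ≤
      Nat.card (W.sha[((p ^ e : ℕ) : ℤ)]) * Nat.card (W.sha[(p : ℤ)]) := by
  haveI : Finite (W.sha[(p : ℤ)]) := W.finite_sha_torsionBy_holds _ (by exact_mod_cast hp.out.ne_zero)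
  exact natCard_torsionBy_pow_succ_le p e

omit [W.IsElliptic] hp in
/-- **Stabilisation is final** (no pairing): if `Ш[p^{e+1}] = Ш[p^e]` then `Ш(E/K)[p^∞] = Ш[p^e]`.
[cite: Greenberg1999LNM, §1 (pp. 54–57)] -/
theorem primaryComponent_sha_eq_torsionBy_of_succ_eq {e : ℕ}
    (h : W.sha[((p ^ (e + 1) : ℕ) : ℤ)] = W.sha[((p ^ e : ℕ) : ℤ)]) :
    AddCommGroup.primaryComponent W.sha p = W.sha[((p ^ e : ℕ) : ℤ)] := by
  refine le_antisymm ?_ (sha_torsionBy_pow_le_primaryComponent W p e)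
  -- every class killed by `p^n` is killed by `p^e`, by induction on `n`
  have key : ∀ n : ℕ, ∀ x : W.sha, p ^ n • x = 0 → p ^ e • x = 0 := by
    intro n
    induction n with
    | zero =>
      intro x hx
      rw [pow_zero, one_smul] at hx
      rw [hx, smul_zero]
    | succ n ih =>
      intro x hx
      by_cases hn : n + 1 ≤ e
      · obtain ⟨i, hi⟩ := Nat.exists_eq_add_of_le hn
        rw [hi, pow_add, mul_comm, ← smul_smul, hx, smul_zero]
      · obtain ⟨i, hi⟩ := Nat.exists_eq_add_of_le (show e ≤ n by omega)
        have hy : p ^ i • x ∈ W.sha[((p ^ (e + 1) : ℕ) : ℤ)] := by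
          rw [AddSubgroup.torsionBy.nsmul_iff, smul_smul, ← pow_add,
            show e + 1 + i = n + 1 by omega, hx]
        rw [h, AddSubgroup.torsionBy.nsmul_iff, smul_smul, ← pow_add, show e + i = n by omega] at hy
        exact ih x hy
  intro x hx
  obtain ⟨n, hn⟩ := (AddCommGroup.mem_primaryComponent).mp hx
  exact AddSubgroup.torsionBy.nsmul_iff.mpr (key n x hn)

/-- **THE SECOND-DESCENT DOOR, subgroup form** (no pairing): if two consecutive descents agree,
`#Ш(E/K)[p^{e+1}] = #Ш(E/K)[p^e]`, then `Ш(E/K)[p^∞] = Ш(E/K)[p^e]` — the COMPLETE `p`-primary component.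
[cite: Greenberg1999LNM, §1 (pp. 54–57)] [cite: SilvermanAEC2009, Thm. X.4.2(b)] -/
theorem primaryComponent_sha_eq_torsionBy_of_natCard_succ_eq {e : ℕ}
    (h : Nat.card (W.sha[((p ^ (e + 1) : ℕ) : ℤ)]) = Nat.card (W.sha[((p ^ e : ℕ) : ℤ)])) :
    AddCommGroup.primaryComponent W.sha p = W.sha[((p ^ e : ℕ) : ℤ)] := by
  haveI := finite_sha_torsionBy_pow W p (e + 1)
  exact primaryComponent_sha_eq_torsionBy_of_succ_eq W p
    (AddSubgroup.eq_of_le_of_card_ge (torsionBy_pow_mono p (Nat.le_succ e)) h.le).symm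

/-- **THE SECOND-DESCENT DOOR** (no pairing): **`#Ш(E/K)[p^{e+1}] = #Ш(E/K)[p^e] ⟹ t_p(E) = 0`**
(`Ш[p^∞] = Ш[p^e]` is finite). The route header's «4-descent with the Cassels–Tate pairing decides
finiteness of `Ш[p₀^∞]` when `Ш[p₀] ≠ 0`», as a tree theorem: `#Ш[4] = #Ш[2]` closes the door at `2`.
[cite: Greenberg1999LNM, §1 (pp. 54–57)] [cite: SilvermanAEC2009, Thm. X.4.2(b)] -/
theorem shaCorank_eq_zero_of_natCard_sha_torsionBy_pow_succ_eq {e : ℕ}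
    (h : Nat.card (W.sha[((p ^ (e + 1) : ℕ) : ℤ)]) = Nat.card (W.sha[((p ^ e : ℕ) : ℤ)])) :
    W.shaCorank p = 0 := by
  haveI := finite_sha_torsionBy_pow W p e
  have hfin : Finite (AddCommGroup.primaryComponent W.sha p) := by
    rw [primaryComponent_sha_eq_torsionBy_of_natCard_succ_eq W p h]; infer_instance
  exact (finite_primaryComponent_sha_iff_shaCorank_eq_zero W p).mp hfin

/-- **`#Ш(E/K)[p²] = #Ш(E/K)[p] ⟹ t_p(E) = 0`** (no pairing): the level-one form of the second-descent door
(e.g. `#Ш[2] = 4 = #Ш[4]` gives `t_2 = 0` with `Ш[2] ≅ (ℤ/2)²`). [cite: Greenberg1999LNM, §1 (pp. 54–57)] -/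
theorem shaCorank_eq_zero_of_natCard_sha_torsionBy_sq_eq
    (h : Nat.card (W.sha[((p ^ 2 : ℕ) : ℤ)]) = Nat.card (W.sha[(p : ℤ)])) : W.shaCorank p = 0 := by
  refine shaCorank_eq_zero_of_natCard_sha_torsionBy_pow_succ_eq W p (e := 1) ?_
  rw [pow_one]
  exact h

/-- After stabilisation every level has the same size: `#Ш[p^{e+1}] = #Ш[p^e] ⟹ #Ш[p^k] = #Ш[p^e]` for all
`k ≥ e` (no pairing). [cite: Greenberg1999LNM, §1 (pp. 54–57)] -/
theorem natCard_sha_torsionBy_pow_eq_of_natCard_succ_eq {e : ℕ}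
    (h : Nat.card (W.sha[((p ^ (e + 1) : ℕ) : ℤ)]) = Nat.card (W.sha[((p ^ e : ℕ) : ℤ)])) {k : ℕ}
    (hk : e ≤ k) : Nat.card (W.sha[((p ^ k : ℕ) : ℤ)]) = Nat.card (W.sha[((p ^ e : ℕ) : ℤ)]) := by
  have hT := primaryComponent_sha_eq_torsionBy_of_natCard_succ_eq W p h
  refine congrArg (fun H : AddSubgroup W.sha ↦ Nat.card H) (le_antisymm ?_ (torsionBy_pow_mono p hk))
  rw [← hT]
  exact sha_torsionBy_pow_le_primaryComponent W p k

/-- **`t_p(E) = 0 ⟺` two consecutive descents agree at some level** (granting Cassels–Tate for `⟹`).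
[cite: Greenberg1999LNM, §1 (pp. 54–57)] [cite: Dokchitser2013ParityNotes, §2] -/
theorem shaCorank_eq_zero_iff_exists_natCard_succ_eq (hCT : exists_casselsTate_pairing (K := K)) :
    W.shaCorank p = 0 ↔ ∃ e : ℕ,
      Nat.card (W.sha[((p ^ (e + 1) : ℕ) : ℤ)]) = Nat.card (W.sha[((p ^ e : ℕ) : ℤ)]) := by
  refine ⟨fun h0 ↦ ?_, fun ⟨e, he⟩ ↦ shaCorank_eq_zero_of_natCard_sha_torsionBy_pow_succ_eq W p he⟩
  obtain ⟨e₀, he₀⟩ := exists_forall_natCard_sha_torsionBy_pow_succ_eq W p hCT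
  exact ⟨e₀, by rw [he₀ e₀ le_rfl, h0, pow_zero, one_mul]⟩

/-- **`t_p(E) = 0 ⟺ #Ш(E/K)[p^e]` is bounded in `e`** (granting Cassels–Tate for `⟹`; `⟸` from
`p^{e t_p} ∣ #Ш[p^e]`). [cite: Greenberg1999LNM, §1 (pp. 54–57)] -/
theorem shaCorank_eq_zero_iff_natCard_bounded (hCT : exists_casselsTate_pairing (K := K)) :
    W.shaCorank p = 0 ↔ ∃ N : ℕ, ∀ e : ℕ, Nat.card (W.sha[((p ^ e : ℕ) : ℤ)]) ≤ N := by
  obtain ⟨m, -, -, ⟨e₀, he₀⟩, h⟩ := exists_sha_levelProfile W p hCT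
  constructor
  · intro h0
    refine ⟨p ^ (2 * m e₀), fun e ↦ ?_⟩
    rw [h e, h0, mul_zero, zero_add]
    rcases le_total e₀ e with hle | hle
    · rw [he₀ e hle]
    · have hmono : m e ≤ m e₀ := by
        have := exists_sha_levelProfile W p hCT
        -- monotonicity read off the counts: `Ш[p^e] ≤ Ш[p^{e₀}]`
        haveI := finite_sha_torsionBy_pow W p e₀
        have hcard := AddSubgroup.card_le_of_le (torsionBy_pow_mono (X := W.sha) p hle)
        rw [h e, h e₀, h0, mul_zero, mul_zero, zero_add, zero_add,
          Nat.pow_le_pow_iff_right hp.out.one_lt] at hcard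
        omega
      exact Nat.pow_le_pow_right hp.out.pos (by omega)
  · rintro ⟨N, hN⟩
    by_contra ht
    have ht1 : 1 ≤ W.shaCorank p := Nat.one_le_iff_ne_zero.mpr ht
    -- `p^e ≤ p^{e t_p} ≤ #Ш[p^e] ≤ N` for every `e`
    have hle : ∀ e, p ^ e ≤ N := fun e ↦ by
      refine le_trans ?_ (hN e)
      rw [h e]
      exact Nat.pow_le_pow_right hp.out.pos (by nlinarith)
    exact absurd (hle N) (not_le.mpr (Nat.lt_pow_self hp.out.one_lt))

/-! ### §4 The `(p, p²)` reading table -/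

/-- **The `(p, p²)` reading table.** If `#Ш(E/K)[p] = p^a` and `#Ш(E/K)[p²] = p^b` then (granting
Cassels–Tate): `b` is even, `a ≤ b ≤ 2a`, **`t_p(E) ≤ b − a`**, and `t_p(E) ≡ a ≡ b − a (mod 2)`. Hence
`b = a ⟹ t_p = 0` (second-descent door), `b = a + 1 ⟹ t_p = 1` (odd step), `(a, b) = (2, 4) ⟹ t_p ∈ {0, 2}`.
[cite: Dokchitser2013ParityNotes, §2] [cite: Cassels1962ArithmeticIV, §1] -/
theorem levelTwo_reading (hCT : exists_casselsTate_pairing (K := K)) {a b : ℕ}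
    (ha : Nat.card (W.sha[(p : ℤ)]) = p ^ a) (hb : Nat.card (W.sha[((p ^ 2 : ℕ) : ℤ)]) = p ^ b) :
    Even b ∧ a ≤ b ∧ b ≤ 2 * a ∧ W.shaCorank p ≤ b - a ∧
      W.shaCorank p % 2 = a % 2 ∧ W.shaCorank p % 2 = (b - a) % 2 := by
  have ha1 : Nat.card (W.sha[((p ^ 1 : ℕ) : ℤ)]) = p ^ a := by rw [pow_one]; exact ha
  obtain ⟨hab, ht, hpar⟩ := shaCorank_le_sub_of_natCard_eq_pow W p hCT (e := 1) ha1 hb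
  have hsq := isSquare_natCard_sha_torsionBy_pow_iff W p hCT 2
  rw [hb, isSquare_prime_pow_iff' p] at hsq
  have hb_even : Even b := hsq.mpr (even_two_mul _)
  have h1 := mul_shaCorank_le_and_mod_two_eq W p hCT (e := 1) ha1
  -- `b ≤ 2a` from `#Ш[p²] ≤ #Ш[p]·#Ш[p]` (no pairing)
  have hb2a : b ≤ 2 * a := by
    have hle := natCard_sha_torsionBy_pow_succ_le W p 1
    rw [hb, ha1, ha, ← pow_add, Nat.pow_le_pow_iff_right hp.out.one_lt] at hle
    omega
  refine ⟨hb_even, hab, hb2a, ht, by omega, hpar⟩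

end Literature.NumberTheory.EllipticCurves

end
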